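import Summits.QuantumFields.BalabanUV.Beta.SymCorrectorTransport
import Summits.QuantumFields.BalabanUV.Beta.RelInvBorderedHessianStep
import Summits.QuantumFields.BalabanUV.Beta.SymCorrectorFace

/-!
# `BalabanUV.Beta.CombChartTransportLevel` — binder row D1 (OWNER an2), SPEC S-an2-g49-1 §1′ ∕ FILE F2, RULING R-D1-g49-1 (ii): **THE CHART TRANSPORT AT EVERY
# LEVEL — `GcombSh Lc j = Ψ̂_S ∘ coDressKBmAt ρ_c Lc (KInvStep Lc j) ∘ Ψ̂_Sᵀ` for ALL `j`** (leaf-03's `SymCorrectorTransport.GcombSh_zero_eq_conj_psiKS_KInvStep` is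
# the level `0`; this file is the level-`(j+1)` twin and the all-levels wrapper), from **`Φ̂_Sᵀ ∘ bhKStep d Lc (j+1) ∘ Φ̂_S = bhKStepSh d Lc (Dsh Lc) (j+1)`** —
# the field block `wVH • E2 (j+1)` is BLIND to the symmetrised corrector (the value Hessian is co-closed in both slots: an2 `ValueHessianBlind`), the borders are
# `stepScale (j+1) •` leaf-03's level-`0` borders, the multiplier block is zero

WHY (SPEC #42 (5) ∕ S-an2-g49-1 §1′, the located PRESENTATION FORK of route T).  The tower door (#21 ∕ #41d `FP/TowerLawFullIndex`) names the top step by the ROOTED PLAIN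
chart `(coDressKBmAt (toSite (rs 0)) Lc (KInvStep Lc (lev 0)), bhKStepAt …)` while M‴'s `TbalOf Lc Js j` at `Js := JsB12CombShSym …` reads the chart-(III′) kernel
`GcombSh Lc j` (`CombChartJointEnd.TbalOf_JsB12CombShSym`); the (L2′) identification `hG` at every `j ≥ 1` (and `hF` at `j = 1`) needs the CHART-CHANGE letter between the
two.  With the roots aligned (`rs k := ctrOff (d+1) Lc`, the row's recommendation) the change is the conjugation by the kernelised symmetrised corrector
`Ψ̂_S = psiKS (ctrOff (d+1) Lc) Lc`: THIS FILE proves it at every level; d1-p2's GENERIC `D1BFx/HessKerConjugation.hessKer_conj_kernel` then moves `Ψ̂_S` onto the jets.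

CONTENT ([folklore]; `Lc ≥ 1` via `[NeZero Lc]`, `ρ_c = ctr (d+1) Lc = toSite (ctrOff (d+1) Lc)`, `Φ̂_S = phiKS (ctrOff (d+1) Lc) Lc`, `Ψ̂_S = psiKS (ctrOff (d+1) Lc) Lc`).
* §1 **THE VALUE HESSIAN IS BLIND TO THE SYMMETRISED CORRECTOR ON BOTH LEGS** (any in-block root `r`, every `j`): the field column of `Φ̂_S` at `(inl β, z)` is
  `δ_{(β,z)} − d g` with the FINITELY SUPPORTED block-constant potential `g = |box|⁻¹ · ext Lc (ζ_S δ_{(β,z)})` (`corrPhiS_indR_eq_sub_dz`, `summable_zetaS_indR_blk` from leaf-03's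
  `SymCorrectorFace.zetaS_indR_of_blk_ne`), so a bounded co-closed row is reproduced (`tsum_mul_corrPhiS_indR` — an2 `ValueHessianBlind.tsum_mul_dz_eq_zero_of_codiff₁`) and
  **`comp_E2_phiKS : E2 d Lc j ∘ Φ̂_S = E2 d Lc j`**, **`comp_trK_phiKS_E2 : Φ̂_Sᵀ ∘ E2 d Lc j = E2 d Lc j`** (`codiff₁_wΦ_right ∕ codiff₁_wΦ_shift`, `E2_inl_inl_eq_wΦ`).
* §2 **`trK_phiKS_bhKStep_phiKS_succ : Φ̂_Sᵀ ∘ bhKStep d Lc (j+1) ∘ Φ̂_S = bhKStepSh d Lc (Dsh Lc) (j+1)`** (centre root), entrywise: `ff` by §1, borders = `stepScale d Lc (j+1) ·`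
  leaf-03's `trK_phiKS_bhK_phiKS_eq_bhK_add_Dsh`, `mm` zero.
* §3 **`relInv_conj_psiKS_bhKStepSh_succ`** (an2's `RelInvCongruenceKernel.relInv_congr_kernel` on an2's straight base `relInv_coDressKBmAt_KInvStep_succ_bhKStep`) and
  **`GcombSh_succ_eq_conj_psiKS_KInvStep`** (leaf-03's `relInv_unique_kernel` against `FP/RelInvPeriodisedComb.relInv_GcombSh_bhKStepSh (j+1)`); the all-levels wrapper
  **`GcombSh_eq_conj_psiKS_KInvStep : ∀ j, GcombSh Lc j = Ψ̂_S ∘ coDressKBmAt ρ_c Lc (KInvStep Lc j) ∘ Ψ̂_Sᵀ`**.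
* §4 corollaries at every level: `colH_GcombSh_eq_corrPsiS` (the packing column transports by `Ψ_S` — leaf-03's `colH_conj_psiKS`), `GcombSh_inr_inr_eq` (the multiplier
  block is untouched).
WHAT THIS IS NOT: not the jets' transport (d1-p2 `hessKer_conj_kernel` + leaf-03 `SymCorrectorSlot.vertexOfK_conj_psiKS`, by name, at the consumer), not (L2′) `hG` itself,
not the composite slot adjunction (F1).  Nothing of Bałaban's asserted; 0 estimates; 0∕4 row-D1 binders (hW, hR, D1Tel, D1Rep); NOT (T-ID), NOT D1, NEVER «G-an2-4 closed»,
NOT BetaPertH, NOT continuum, NOT Clay.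

HONEST DEPENDENCY (page 1, mandatory): continuum YM on T⁴ ⇐ BetaPertH ∧ nine spine estimates (0/9 proved); BetaPertH ⇐ (D1) ∧ (D4) ∧ CAP+tail;
G-an2-4 gates asym, D1 and NE2/3/4.  HONEST FRAMING (cell contract, verbatim): «discharging `BetaPertH` makes Bałaban's UV stability UNCONDITIONAL —
a real constructive-QFT result; it is NOT the continuum limit and NOT the Clay problem.»  ABSOLUTE RULE (cell charter, verbatim): «No internally-minted
statement may enter as a cited fact. Every hypothesis is either kernel-proved in this package or a verbatim quotation of a PUBLISHED theorem with page
reference. The manuscript(s) under audit are NOT citable for their own disputed steps — they are the thing under adjudication; programme-internal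
(2001/route/tribunal) claims are never citable.»  [folklore] absolutely-convergent-sum bookkeeping over OUR typed objects BY NAME; no `def`, no `def … : Prop`,
nothing cited, 0 sorry.  Row D1 OWNER an2 (b2b-balaban-beta-an2) gen 49, 2026-08-23.  No existing file touched.
-/

noncomputable section

namespace Summit.QuantumFields.BalabanUV.Beta.CombChartTransportLevel

open Finset
open scoped BigOperators
open Literature.Probability.LatticeModels (Torus.proj)
open Literature.MathematicalPhysics.QuantumFieldTheory
open Literature.MathematicalPhysics.QuantumFieldTheory.Balaban1983to89
open Literature.MathematicalPhysics.QuantumFieldTheory.Balaban1983to89.Beta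
open ExpKernelCalculus (MKer comp)
open AffineAveraging (Form0 Form1 Site box toSite unitVec dz codiff₁)
open AveragingContours (blk)
open AveragingContoursRooted (ctr ctrOff ctrOff_mem_box)
open AxialProjector (zsmul_blk_le lt_zsmul_blk_add)
open KKTFluctuationKernel (delta1 delta1_apply)
open KKTFluctuationEnergy (summable_mul_of_bdd summable_dz)
open KernelSpecInstance (wΦ)
open OneStepResolventKernel (Fib)
open OneStepKernelFamily (KInvStep colH)
open BalabanStepJetsSucc (E2)
open Summit.QuantumFields.BalabanUV.Beta.TameKernelCalculus (Spr trK trK_apply Spr.trK)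
open Summit.QuantumFields.BalabanUV.Beta.ChartConjugationRelative (RelInv spr_comp)
open Summit.QuantumFields.BalabanUV.Beta.RelInvCongruenceKernel (relInv_congr_kernel)
open Summit.QuantumFields.BalabanUV.Beta.AxialDressingRooted (axEc spr_axEc trK_axEc coDressKBmAt spr_coDressKBmAt)
open Summit.QuantumFields.BalabanUV.Beta.BorderedHessian (bhK bhKStep bhKStep_succ_inl_inl bhKStep_succ_inl_inr bhKStep_succ_inr_inl bhKStep_succ_inr_inr spr_bhKStep
  spr_KInvStep relInv_coDressKBmAt_KInvStep_succ_bhKStep E2_inl_inl_eq_wΦ E2_inl_inr E2_inr codiff₁_wΦ_shift codiff₁_wΦ_right exists_abs_wΦ_le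
  tsum_mul_dz_eq_zero_of_codiff₁)
open Summit.QuantumFields.BalabanUV.Beta.DshAn1 (Dsh)
open Summit.QuantumFields.BalabanUV.Beta.SymShiftedSpread (bhKStepSh bhKStepSh_apply)
open Summit.QuantumFields.BalabanUV.Beta.CombChartStepJets (GcombSh)
open Summit.QuantumFields.BalabanUV.Beta.CombChartContactFactor (spr_GcombSh)
open Summit.QuantumFields.BalabanUV.Beta.FP.RelInvPeriodisedComb (relInv_GcombSh_bhKStepSh spr_bhKStepSh_Dsh)
open Summit.QuantumFields.BalabanUV.Beta.SymCorrectorForms (corrPhiS corrPsiS corrPhiS_apply zetaS)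
open Summit.QuantumFields.BalabanUV.Beta.SymCorrectorFace (zetaS_indR_of_blk_ne)
open Summit.QuantumFields.BalabanUV.Beta.CompositeCorrectorKernel (indR indR_apply)
open Summit.QuantumFields.BalabanUV.Beta.CompositeCorrectorBordered (indR_eq_delta1)
open Summit.QuantumFields.BalabanUV.Beta.SymCorrectorKernel (psiKS phiKS phiKS_inl_inl phiKS_inl_inr phiKS_inr_inl phiKS_inr_inr spr_psiKS spr_phiKS
  comp_psiKS_phiKS comp_phiKS_psiKS comp_comp_axEc_psiKS comp_comp_axEc_phiKS)
open Summit.QuantumFields.BalabanUV.Beta.SymCorrectorTransport (comp_trK_phiKS_inl_left comp_trK_phiKS_inr_left comp_phiKS_inr_right comp_bhK_phiKS_inr_inl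
  comp_trK_phiKS_bhK_inl_inr trK_phiKS_bhK_phiKS_eq_bhK_add_Dsh relInv_unique_kernel GcombSh_zero_eq_conj_psiKS_KInvStep colH_conj_psiKS conj_psiKS_inr_inr)

variable {d : ℕ}

/-! ## §1 The value Hessian is blind to the symmetrised corrector on both legs -/

section Blind

variable {n : ℕ} (hn : 0 < n) {r : Fin (d + 1) → ℕ} (hr : r ∈ box (d + 1) n)
include hn hr

/-- [folklore] **THE CORRECTION POTENTIAL OF A BOND INDICATOR IS SUMMABLE**: `y ↦ |box|⁻¹ · ζ_S(δ_{(β,z)})(blk n y)` is supported in the block of `z`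
(leaf-03 `zetaS_indR_of_blk_ne`), hence summable (the `ValueHessianBlind.summable_bmGaugeAt_delta1` pattern). -/
theorem summable_zetaS_indR_blk (β : Fin (d + 1)) (z : Site (d + 1)) :
    Summable (fun y : Site (d + 1) => (((box (d + 1) n).card : ℝ))⁻¹ * zetaS (toSite r) n (indR β z) (blk n y)) := by
  have hn1 : 1 ≤ n := hn
  refine summable_of_ne_finset_zero (s := Fintype.piFinset fun j : Fin (d + 1) => Finset.Icc (z j - n) (z j + n)) fun p hp => ?_
  rw [Fintype.mem_piFinset] at hp
  obtain ⟨j, hj⟩ := not_forall.mp hp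
  rw [Finset.mem_Icc, not_and_or, not_le, not_le] at hj
  have hne : blk n z ≠ blk n p := by
    intro h
    have a1 := zsmul_blk_le hn1 p j
    have a2 := lt_zsmul_blk_add hn1 p j
    have b1 := zsmul_blk_le hn1 z j
    have b2 := lt_zsmul_blk_add hn1 z j
    rw [h] at b1 b2
    rcases hj with h' | h' <;> omega
  rw [zetaS_indR_of_blk_ne hn hr β hne, mul_zero]

omit hn hr in
/-- [folklore] **THE FIELD COLUMN OF `Φ̂_S` IS `δ − d g`**: `corrPhiS ρ n (indR β z) l y = δ_{(β,z)}(l, y) − (d g)_l(y)` with `g y = |box|⁻¹ · ζ_S(δ_{(β,z)})(blk n y)`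
(`corrPhiS_apply`, `indR_eq_delta1`). -/
theorem corrPhiS_indR_eq_sub_dz (β : Fin (d + 1)) (z : Site (d + 1)) (l : Fin (d + 1)) (y : Site (d + 1)) :
    corrPhiS (toSite r) n (indR β z) l y
      = delta1 β z l y - dz (fun y : Site (d + 1) => (((box (d + 1) n).card : ℝ))⁻¹ * zetaS (toSite r) n (indR β z) (blk n y)) l y := by
  rw [corrPhiS_apply, indR_eq_delta1]
  simp only [dz]
  ring

/-- [folklore] **A BOUNDED CO-CLOSED ROW IS REPRODUCED BY THE FIELD COLUMN OF `Φ̂_S`**: `∑'_y ∑_l A_l(y) · corrPhiS ρ n (indR β z) l y = A_β(z)` — the exact part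
`d g` pairs to zero with `A` (summation by parts, `tsum_mul_dz_eq_zero_of_codiff₁`), the indicator picks the entry. -/
theorem tsum_mul_corrPhiS_indR {A : Form1 (d + 1) ℝ} {C : ℝ} (hA : ∀ l y, |A l y| ≤ C) (hco : codiff₁ A = 0) (z : Site (d + 1)) (β : Fin (d + 1)) :
    ∑' y, ∑ l, A l y * corrPhiS (toSite r) n (indR β z) l y = A β z := by
  have e : ∀ (y : Site (d + 1)) (l : Fin (d + 1)), corrPhiS (toSite r) n (indR β z) l y = delta1 β z l y
      - dz (fun y : Site (d + 1) => (((box (d + 1) n).card : ℝ))⁻¹ * zetaS (toSite r) n (indR β z) (blk n y)) l y :=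
    fun y l => corrPhiS_indR_eq_sub_dz β z l y
  simp_rw [e, mul_sub, Finset.sum_sub_distrib]
  have hδ : ∀ y, y ≠ z → ∑ l, A l y * delta1 β z l y = 0 := fun y hy =>
    Finset.sum_eq_zero fun l _ => by rw [delta1_apply, if_neg (fun h => hy h.2), mul_zero]
  have hs1 : Summable fun y => ∑ l, A l y * delta1 β z l y :=
    summable_of_ne_finset_zero (s := {z}) fun y hy => hδ y (by rwa [Finset.mem_singleton] at hy)
  have hg := summable_zetaS_indR_blk hn hr β z
  have hs2 : Summable fun y => ∑ l, A l y
      * dz (fun y : Site (d + 1) => (((box (d + 1) n).card : ℝ))⁻¹ * zetaS (toSite r) n (indR β z) (blk n y)) l y :=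
    summable_sum fun l _ => summable_mul_of_bdd (hA l) (summable_dz hg l)
  rw [hs1.tsum_sub hs2, tsum_mul_dz_eq_zero_of_codiff₁ hA hco hg, sub_zero, tsum_eq_single z hδ,
    Finset.sum_eq_single β (fun l _ hl => by rw [delta1_apply, if_neg (fun h => hl h.1), mul_zero])
      (fun h => (h (Finset.mem_univ β)).elim),
    delta1_apply, if_pos ⟨rfl, rfl⟩, mul_one]

end Blind

section E2Blind

variable {Lc : ℕ} [NeZero Lc] {r : Fin (d + 1) → ℕ} (hr : r ∈ box (d + 1) Lc)
include hr

/-- [folklore] **RIGHT BLINDNESS OF THE VALUE HESSIAN TO THE SYMMETRISED CORRECTOR**: `E2 d Lc j ∘ Φ̂_S = E2 d Lc j` (every `j`, every in-block root `r`;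
second-slot co-closedness `codiff₁_wΦ_right`). -/
theorem comp_E2_phiKS (j : ℕ) : comp (E2 d Lc j) (phiKS r Lc) = E2 d Lc j := by
  have hLc : 0 < Lc := Nat.pos_of_ne_zero (NeZero.ne Lc)
  obtain ⟨C, hC⟩ := exists_abs_wΦ_le (N := Lc ^ j) (d := d)
  funext x z a b
  unfold ExpKernelCalculus.comp
  rcases a with κ | m
  · rcases b with β | m
    · have e : ∀ y, ∑ f : Fib d, E2 d Lc j x y (Sum.inl κ) f * phiKS r Lc y z f (Sum.inl β) =
          ∑ l, (fun l y => wΦ (N := Lc ^ j) κ l (x - y)) l y * corrPhiS (toSite r) Lc (indR β z) l y := by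
        intro y
        rw [Fintype.sum_sum_type]
        simp only [E2_inl_inl_eq_wΦ, E2_inl_inr, zero_mul, Finset.sum_const_zero, add_zero, phiKS_inl_inl]
      simp_rw [e]
      rw [tsum_mul_corrPhiS_indR hLc hr (A := fun l y => wΦ (N := Lc ^ j) κ l (x - y)) (fun l y => hC κ l (x - y)) (codiff₁_wΦ_right κ x) z β,
        E2_inl_inl_eq_wΦ]
    · have e : ∀ y, ∑ f : Fib d, E2 d Lc j x y (Sum.inl κ) f * phiKS r Lc y z f (Sum.inr m) = 0 := by
        intro y
        rw [Fintype.sum_sum_type]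
        simp only [phiKS_inl_inr, mul_zero, Finset.sum_const_zero, zero_add, E2_inl_inr, zero_mul]
      simp_rw [e]
      rw [tsum_zero, E2_inl_inr]
  · simp only [E2_inr, zero_mul, Finset.sum_const_zero, tsum_zero]

/-- [folklore] **LEFT BLINDNESS OF THE VALUE HESSIAN TO THE SYMMETRISED CORRECTOR**: `Φ̂_Sᵀ ∘ E2 d Lc j = E2 d Lc j` (first-slot co-closedness
`codiff₁_wΦ_shift`; no symmetry needed). -/
theorem comp_trK_phiKS_E2 (j : ℕ) : comp (trK (phiKS r Lc)) (E2 d Lc j) = E2 d Lc j := by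
  have hLc : 0 < Lc := Nat.pos_of_ne_zero (NeZero.ne Lc)
  obtain ⟨C, hC⟩ := exists_abs_wΦ_le (N := Lc ^ j) (d := d)
  funext x z a b
  rcases a with α | m
  · rw [comp_trK_phiKS_inl_left]
    rcases b with β | m'
    · have e : ∀ y, ∑ l : Fin (d + 1), corrPhiS (toSite r) Lc (indR α x) l y * E2 d Lc j y z (Sum.inl l) (Sum.inl β) =
          ∑ l, (fun l y => wΦ (N := Lc ^ j) l β (y - z)) l y * corrPhiS (toSite r) Lc (indR α x) l y := by
        intro y
        refine Finset.sum_congr rfl fun l _ => ?_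
        rw [E2_inl_inl_eq_wΦ, mul_comm]
      simp_rw [e]
      rw [tsum_mul_corrPhiS_indR hLc hr (A := fun l y => wΦ (N := Lc ^ j) l β (y - z)) (fun l y => hC l β (y - z)) (codiff₁_wΦ_shift β z) x α,
        E2_inl_inl_eq_wΦ]
    · have e : ∀ y, ∑ l : Fin (d + 1), corrPhiS (toSite r) Lc (indR α x) l y * E2 d Lc j y z (Sum.inl l) (Sum.inr m') = 0 := by
        intro y
        refine Finset.sum_eq_zero fun l _ => ?_
        rw [E2_inl_inr, mul_zero]
      simp_rw [e]
      rw [tsum_zero, E2_inl_inr]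
  · rw [comp_trK_phiKS_inr_left]

end E2Blind

/-! ## §2 The re-linearised straight step candidate at the centre root is the sym-shifted step operator -/

section Step

variable {Lc : ℕ} [NeZero Lc]

/-- [folklore] The inner kernel `Φ̂_Sᵀ ∘ bhKStep (j+1)`, field–field entry: `wVH (j+1) · E2 (j+1)` (left blindness, entrywise). -/
theorem comp_trK_phiKS_bhKStep_succ_inl_inl {r : Fin (d + 1) → ℕ} (hr : r ∈ box (d + 1) Lc) (j : ℕ) (x y : Site (d + 1)) (α l : Fin (d + 1)) :
    comp (trK (phiKS r Lc)) (bhKStep d Lc (j + 1)) x y (Sum.inl α) (Sum.inl l)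
      = BalabanStepJetsSucc.wVH d Lc (j + 1) * E2 d Lc (j + 1) x y (Sum.inl α) (Sum.inl l) := by
  have h := congrFun (congrFun (congrFun (congrFun (comp_trK_phiKS_E2 (d := d) hr (j + 1)) x) y) (Sum.inl α)) (Sum.inl l)
  rw [comp_trK_phiKS_inl_left] at h ⊢
  have e : ∀ w, ∑ l' : Fin (d + 1), corrPhiS (toSite r) Lc (indR α x) l' w * bhKStep d Lc (j + 1) w y (Sum.inl l') (Sum.inl l) =
      BalabanStepJetsSucc.wVH d Lc (j + 1) * ∑ l' : Fin (d + 1), corrPhiS (toSite r) Lc (indR α x) l' w * E2 d Lc (j + 1) w y (Sum.inl l') (Sum.inl l) := by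
    intro w
    rw [Finset.mul_sum]
    refine Finset.sum_congr rfl fun l' _ => ?_
    rw [bhKStep_succ_inl_inl]
    ring
  simp_rw [e]
  rw [tsum_mul_left, h]

/-- [folklore] The inner kernel `Φ̂_Sᵀ ∘ bhKStep (j+1)`, field–multiplier entry: `stepScale (j+1) ·` that of `Φ̂_Sᵀ ∘ bhK`. -/
theorem comp_trK_phiKS_bhKStep_succ_inl_inr (r : Fin (d + 1) → ℕ) (j : ℕ) (x y : Site (d + 1)) (α m : Fin (d + 1)) :
    comp (trK (phiKS r Lc)) (bhKStep d Lc (j + 1)) x y (Sum.inl α) (Sum.inr m)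
      = BorderedHessian.stepScale d Lc (j + 1) * comp (trK (phiKS r Lc)) (bhK Lc) x y (Sum.inl α) (Sum.inr m) := by
  rw [comp_trK_phiKS_inl_left, comp_trK_phiKS_inl_left, ← tsum_mul_left]
  refine tsum_congr fun w => ?_
  rw [Finset.mul_sum]
  refine Finset.sum_congr rfl fun l' _ => ?_
  rw [bhKStep_succ_inl_inr]
  ring

/-- [folklore] **`Φ̂_Sᵀ ∘ bhKStep d Lc (j+1) ∘ Φ̂_S = bhKStepSh d Lc (Dsh Lc) (j+1)`** at the centre root (`Φ̂_S = phiKS (ctrOff (d+1) Lc) Lc`): the field block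
`wVH • E2` is blind on both legs (§1), the borders are `stepScale (j+1) ·` those of `Φ̂_Sᵀ ∘ bhK Lc ∘ Φ̂_S = bhK Lc + Dsh Lc` (leaf-03), the multiplier block is `0`. -/
theorem trK_phiKS_bhKStep_phiKS_succ (j : ℕ) :
    comp (comp (trK (phiKS (ctrOff (d + 1) Lc) Lc)) (bhKStep d Lc (j + 1))) (phiKS (ctrOff (d + 1) Lc) Lc) = bhKStepSh d Lc (Dsh Lc) (j + 1) := by
  have hLc : 0 < Lc := Nat.pos_of_ne_zero (NeZero.ne Lc)
  have hr : ctrOff (d + 1) Lc ∈ box (d + 1) Lc := ctrOff_mem_box hLc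
  have h0 := trK_phiKS_bhK_phiKS_eq_bhK_add_Dsh (d := d) Lc
  obtain ⟨C, hC⟩ := exists_abs_wΦ_le (N := Lc ^ (j + 1)) (d := d)
  funext x z a b
  rcases b with β | μ
  · -- field columns: unfold the outer composition; the multiplier legs of `Φ̂_S`'s field column vanish
    have eo : comp (comp (trK (phiKS (ctrOff (d + 1) Lc) Lc)) (bhKStep d Lc (j + 1))) (phiKS (ctrOff (d + 1) Lc) Lc) x z a (Sum.inl β)
        = ∑' y, ∑ l : Fin (d + 1), comp (trK (phiKS (ctrOff (d + 1) Lc) Lc)) (bhKStep d Lc (j + 1)) x y a (Sum.inl l)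
            * corrPhiS (toSite (ctrOff (d + 1) Lc)) Lc (indR β z) l y := by
      unfold ExpKernelCalculus.comp
      refine tsum_congr fun y => ?_
      rw [Fintype.sum_sum_type]
      simp only [phiKS_inr_inl, mul_zero, Finset.sum_const_zero, add_zero, phiKS_inl_inl]
    rw [eo]
    rcases a with α | κ
    · -- ff
      have e : ∀ y, ∑ l : Fin (d + 1), comp (trK (phiKS (ctrOff (d + 1) Lc) Lc)) (bhKStep d Lc (j + 1)) x y (Sum.inl α) (Sum.inl l)
            * corrPhiS (toSite (ctrOff (d + 1) Lc)) Lc (indR β z) l y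
          = BalabanStepJetsSucc.wVH d Lc (j + 1) * ∑ l, (fun l y => wΦ (N := Lc ^ (j + 1)) α l (x - y)) l y * corrPhiS (toSite (ctrOff (d + 1) Lc)) Lc (indR β z) l y := by
        intro y
        rw [Finset.mul_sum]
        refine Finset.sum_congr rfl fun l _ => ?_
        simp only [comp_trK_phiKS_bhKStep_succ_inl_inl hr, E2_inl_inl_eq_wΦ]
        ring
      simp_rw [e]
      rw [tsum_mul_left, tsum_mul_corrPhiS_indR hLc hr (A := fun l y => wΦ (N := Lc ^ (j + 1)) α l (x - y)) (fun l y => hC α l (x - y))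
        (codiff₁_wΦ_right α x) z β, ← E2_inl_inl_eq_wΦ, bhKStepSh_apply]
      simp only [Pi.add_apply, Pi.smul_apply, smul_eq_mul, bhKStep_succ_inl_inl, DshAn1.Dsh_inl_inl, mul_zero, add_zero]
    · -- mf
      have e : ∀ y, ∑ l : Fin (d + 1), comp (trK (phiKS (ctrOff (d + 1) Lc) Lc)) (bhKStep d Lc (j + 1)) x y (Sum.inr κ) (Sum.inl l)
            * corrPhiS (toSite (ctrOff (d + 1) Lc)) Lc (indR β z) l y
          = BorderedHessian.stepScale d Lc (j + 1) * ∑ f : Fib d, bhK Lc x y (Sum.inr κ) f * phiKS (ctrOff (d + 1) Lc) Lc y z f (Sum.inl β) := by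
        intro y
        rw [Fintype.sum_sum_type]
        simp only [phiKS_inr_inl, mul_zero, Finset.sum_const_zero, add_zero, phiKS_inl_inl]
        rw [Finset.mul_sum]
        refine Finset.sum_congr rfl fun l _ => ?_
        rw [comp_trK_phiKS_inr_left, bhKStep_succ_inr_inl]
        ring
      simp_rw [e]
      rw [tsum_mul_left]
      have hc : (∑' y, ∑ f : Fib d, bhK Lc x y (Sum.inr κ) f * phiKS (ctrOff (d + 1) Lc) Lc y z f (Sum.inl β))
          = comp (bhK Lc) (phiKS (ctrOff (d + 1) Lc) Lc) x z (Sum.inr κ) (Sum.inl β) := rfl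
      have h0e := congrFun (congrFun (congrFun (congrFun h0 x) z) (Sum.inr κ)) (Sum.inl β)
      rw [SymCorrectorTransport.comp_comp_trK_phiKS_bhK_phiKS_inl] at h0e
      rw [hc, h0e, bhKStepSh_apply]
      simp only [Pi.add_apply, Pi.smul_apply, smul_eq_mul, bhKStep_succ_inr_inl]
      ring
  · -- multiplier columns are picked
    rw [comp_phiKS_inr_right]
    rcases a with α | κ
    · -- fm
      have h0e := congrFun (congrFun (congrFun (congrFun h0 x) z) (Sum.inl α)) (Sum.inr μ)
      rw [comp_phiKS_inr_right] at h0e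
      rw [comp_trK_phiKS_bhKStep_succ_inl_inr, h0e, bhKStepSh_apply]
      simp only [Pi.add_apply, Pi.smul_apply, smul_eq_mul, bhKStep_succ_inl_inr]
      ring
    · -- mm
      rw [comp_trK_phiKS_inr_left, bhKStep_succ_inr_inr, bhKStepSh_apply]
      simp only [Pi.add_apply, Pi.smul_apply, smul_eq_mul, bhKStep_succ_inr_inr, DshAn1.Dsh_inr_inr, mul_zero, add_zero]

end Step

/-! ## §3 The relative inverse transported; the chart transport at every level -/

section Transport

variable (Lc : ℕ) [NeZero Lc]

/-- [folklore] **`RelInv (Ψ̂_S ∘ coDressKBmAt ρ_c Lc (KInvStep Lc (j+1)) ∘ Ψ̂_Sᵀ) (bhKStepSh d Lc (Dsh Lc) (j+1)) (axEc ρ_c Lc)`** — an2's generic congruence transfer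
`relInv_congr_kernel` applied to the STRAIGHT base `relInv_coDressKBmAt_KInvStep_succ_bhKStep` with the corrector pair `(Ψ̂_S, Φ̂_S)` (leaf-03 TT2a letters) and §2. -/
theorem relInv_conj_psiKS_bhKStepSh_succ (j : ℕ) :
    RelInv (comp (comp (psiKS (ctrOff (d + 1) Lc) Lc) (coDressKBmAt (ctr (d + 1) Lc) Lc (KInvStep (d := d) Lc (j + 1)))) (trK (psiKS (ctrOff (d + 1) Lc) Lc)))
      (bhKStepSh d Lc (Dsh Lc) (j + 1)) (axEc (ctr (d + 1) Lc) Lc) := by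
  have hLc : 0 < Lc := Nat.pos_of_ne_zero (NeZero.ne Lc)
  have hr : ctrOff (d + 1) Lc ∈ box (d + 1) Lc := ctrOff_mem_box hLc
  rw [← trK_phiKS_bhKStep_phiKS_succ (d := d) j]
  exact relInv_congr_kernel (spr_coDressKBmAt hLc hr (spr_KInvStep (j + 1))) (spr_bhKStep (j + 1)) (spr_axEc _ _) (spr_psiKS hLc hr) (spr_phiKS hLc hr)
    (relInv_coDressKBmAt_KInvStep_succ_bhKStep hr j) (comp_psiKS_phiKS hLc hr) (comp_phiKS_psiKS hLc hr) (trK_axEc _ _)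
    (comp_comp_axEc_psiKS _ Lc hr) (comp_comp_axEc_phiKS _ Lc hr)

/-- [folklore] **THE CHART TRANSPORT AT LEVEL `j+1`: `GcombSh Lc (j+1) = Ψ̂_S ∘ coDressKBmAt ρ_c Lc (KInvStep Lc (j+1)) ∘ Ψ̂_Sᵀ`** — uniqueness of the relative inverse
(leaf-03 `relInv_unique_kernel`) between the chart-(III′) triple (`FP/RelInvPeriodisedComb.relInv_GcombSh_bhKStepSh (j+1)`) and the transported rooted bm triple above. -/
theorem GcombSh_succ_eq_conj_psiKS_KInvStep (j : ℕ) :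
    GcombSh (d := d) Lc (j + 1)
      = comp (comp (psiKS (ctrOff (d + 1) Lc) Lc) (coDressKBmAt (ctr (d + 1) Lc) Lc (KInvStep (d := d) Lc (j + 1)))) (trK (psiKS (ctrOff (d + 1) Lc) Lc)) := by
  have hLc : 0 < Lc := Nat.pos_of_ne_zero (NeZero.ne Lc)
  have hr : ctrOff (d + 1) Lc ∈ box (d + 1) Lc := ctrOff_mem_box hLc
  have hΨ : Spr (psiKS (d := d) (ctrOff (d + 1) Lc) Lc) := spr_psiKS hLc hr
  exact relInv_unique_kernel (spr_GcombSh (d := d) (Lc := Lc) (j + 1))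
    (spr_comp (spr_comp hΨ (spr_coDressKBmAt hLc hr (spr_KInvStep (j + 1)))) hΨ.trK)
    (spr_bhKStepSh_Dsh (j + 1)) (spr_axEc _ _) (relInv_GcombSh_bhKStepSh (d := d) (Lc := Lc) (j + 1)) (relInv_conj_psiKS_bhKStepSh_succ Lc j)

/-- [folklore] **THE CHART TRANSPORT AT EVERY LEVEL**: `GcombSh Lc j = Ψ̂_S ∘ coDressKBmAt ρ_c Lc (KInvStep Lc j) ∘ Ψ̂_Sᵀ` for all `j` (level `0`: leaf-03's
`GcombSh_zero_eq_conj_psiKS_KInvStep`; level `j+1`: above). -/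
theorem GcombSh_eq_conj_psiKS_KInvStep : ∀ j : ℕ,
    GcombSh (d := d) Lc j
      = comp (comp (psiKS (ctrOff (d + 1) Lc) Lc) (coDressKBmAt (ctr (d + 1) Lc) Lc (KInvStep (d := d) Lc j))) (trK (psiKS (ctrOff (d + 1) Lc) Lc))
  | 0 => GcombSh_zero_eq_conj_psiKS_KInvStep Lc
  | j + 1 => GcombSh_succ_eq_conj_psiKS_KInvStep Lc j

end Transport

/-! ## §4 Corollaries at every level: the packing column transports by `Ψ_S`; the multiplier block is untouched -/

section Columns

variable (Lc : ℕ) [NeZero Lc]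

/-- [folklore] **THE `ℋ`-COLUMN OF `GcombSh Lc j` IS `Ψ_S` OF THE ROOTED bm STEP RESOLVENT's, AT EVERY LEVEL** (leaf-03's (T-col) `colH_conj_psiKS` on §3):
`colH (GcombSh Lc j) Lc μ y = corrPsiS ρ_c Lc (colH (coDressKBmAt ρ_c Lc (KInvStep Lc j)) Lc μ y)`. -/
theorem colH_GcombSh_eq_corrPsiS (j : ℕ) (μ : Fin (d + 1)) (y : Fin (d + 1) → ℤ) :
    colH (GcombSh (d := d) Lc j) Lc μ y = corrPsiS (ctr (d + 1) Lc) Lc (colH (coDressKBmAt (ctr (d + 1) Lc) Lc (KInvStep (d := d) Lc j)) Lc μ y) := by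
  have hLc : 0 < Lc := Nat.pos_of_ne_zero (NeZero.ne Lc)
  have hr : ctrOff (d + 1) Lc ∈ box (d + 1) Lc := ctrOff_mem_box hLc
  rw [GcombSh_eq_conj_psiKS_KInvStep Lc j]
  exact colH_conj_psiKS hLc hr _ μ y

/-- [folklore] **THE MULTIPLIER–MULTIPLIER BLOCK OF `GcombSh Lc j` IS THAT OF THE ROOTED bm STEP RESOLVENT, AT EVERY LEVEL** (`conj_psiKS_inr_inr`). -/
theorem GcombSh_inr_inr_eq (j : ℕ) (x z : Fin (d + 1) → ℤ) (m m' : Fin (d + 1)) :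
    GcombSh (d := d) Lc j x z (Sum.inr m) (Sum.inr m')
      = coDressKBmAt (ctr (d + 1) Lc) Lc (KInvStep (d := d) Lc j) x z (Sum.inr m) (Sum.inr m') := by
  rw [GcombSh_eq_conj_psiKS_KInvStep Lc j]
  exact conj_psiKS_inr_inr _ x z m m'

end Columns

end Summit.QuantumFields.BalabanUV.Beta.CombChartTransportLevel

end
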